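import Literature.Analysis.FluidPDE.FractionalNSTorus
import Literature.Analysis.FluidPDE.BuckmasterVicol
import HarnessLib

/-!
# Barrier: weak solutions stay non-unique under any hyperviscosity below J.-L. Lions' exponent 5/4

Barrier catalogue `Literature/Barriers/NavierStokesRegularity/` (D-0021), entry for
`NavierStokesRegularity/NavierStokesRegularity`. J.-L. Lions' exponent `θ = 5/4` for the
fractional system `∂ₜv + ∇·(v⊗v) + ∇p + ν(-Δ)^θ v = 0` on `𝕋³` is the value at which the kinetic
energy becomes scale-invariant (`(d+2)/4`, `d = 3`; cf. the catalogue entry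
`EnergySupercriticality`); for `θ ≥ 5/4` weak solutions are unique (Lions 1969). The theorem
vendored here (Luo–Titi 2020) shows that Buckmaster–Vicol non-uniqueness of `C⁰_t L²_x` weak
solutions persists for every `θ < 5/4`: the exponent is sharp.

## What the source prints (Luo–Titi 2020, held arXiv text pp. 2–4)

* Abstract: "it is shown the existence of non-unique weak solutions for the 3D Navier–Stokes
  equations with fractional hyperviscosity `(-Δ)^θ`, whenever the exponent `θ` is less than
  J.-L. Lions' exponent `5/4`, i.e., when `θ < 5/4`."
* §1: the system (1.1) on `𝕋³` with `ν(-Δ)^θ v`, the fractional Laplacian defined "via the Fourier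
  transform as `𝓕((-Δ)^θ u)(ξ) = |ξ|^{2θ} 𝓕(u)(ξ)`, `ξ ∈ ℤ³`" for zero-mean smooth `u`; Def. 1.1:
  "A vector field `v ∈ C⁰_weak(ℝ; L²(𝕋³))` is called a weak solution to the FVNSE if it solves
  (1.1) in the sense of distribution"; "J.-L. Lions first considered FVNSE (1.1) in [Lions59], and
  showed the existence and uniqueness of weak solutions to the initial value problem, which also
  satisfied the energy equality, for `θ ∈ [5/4, ∞)` in [Lions69]. Moreover, an analogue of the
  Caffarelli–Kohn–Nirenberg result was established in [KatzPavlovic] … showing that the Hausdorff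
  dimension of the singular set, in space and time, is bounded by `5 - 4θ` for `θ ∈ (1, 5/4)`";
  "Colombo, De Lellis and De Rosa … showed the non-uniqueness of Leray weak solutions … for
  `θ ∈ (0, 1/5)` and for `θ ∈ (0, 1/3)` in [DeRosa19]."
* **Theorem 1** (Thm. 1.1 of the journal numbering is not visible in the held text; cited as
  "§1 main theorem"): "Assume that `θ ∈ [1, 5/4)`. Suppose `u` is a smooth divergence-free vector
  field, define[d] on `ℝ₊ × 𝕋³`, with compact support in time and satisfies the condition
  `∫_{𝕋³} u(t,x) dx ≡ 0`. Then for any given `ε₀ > 0`, there exists a weak solution `v` to the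
  FVNSE (1.1), with compact support in time, satisfying `‖v - u‖_{L^∞_t W^{2θ-1,1}_x} < ε₀`. As a
  consequence there are infinitely many weak solutions of the FVNSE (1.1) which are compactly
  supported in time; in particular, there are infinitely many weak solutions with initial values
  zero."
* Remark 1: with a different choice of parameters "Theorem 1.2 and Theorem 1.3 in [BV17] hold for
  the 3D FVNSE, i.e., there exist non-unique weak solutions `v ∈ C⁰_t W^{β,2}_x`"; Remark 2: for
  `θ ∈ (-∞, 1)` the same construction yields weak solutions `v ∈ C⁰_t L²_x ∩ C⁰_t W^{1,1}_x`;
  §1: "As it is shown in the crucial estimate (est-R-linear), the error is controllable only for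
  `θ < 5/4`"; §2.1, Lemma 1 (Iteration Lemma for `L²` weak solutions), stated for `θ ∈ (-∞, 5/4)`.

## Formal content

Named fact (not proved here) `LuoTiti2020_infinitelyMany`: the "As a consequence" clause of
Theorem 1 — for `θ ∈ [1, 5/4)` and `ν > 0`, infinitely many weak solutions on the time line
(`Torus.IsWeakFracNSSolutionLine`, Luo–Titi Def. 1.1, from `FractionalNSTorus`) with compact
support in time and zero initial values (vanishing for `t ≤ 0`), pairwise distinct in `L²` at some
time. The approximation clause `‖v - u‖_{L^∞_t W^{2θ-1,1}_x} < ε₀` is not transcribed (no `W^{s,1}`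
scale in the tree). Catalogue entry `LionsExponentSharpness := LuoTiti2020_infinitelyMany`.

## Audit (D-0021 barrier audit, refuter, 2026-08-16): NARROWED in coverage, confirmed in content

The formal content (`LuoTiti2020_infinitelyMany`) is a faithful, slightly weakened transcription
of the printed consequence clause and is current; in the tree it is moreover reduced to the single
named fact `Torus.LuoTiti2020_iterationLemma` (`LionsExponentSharpnessIteration`). What the audit
narrows is the CLAIMED COVERAGE of the structured block, in two directions, each with a kernel
theorem at the end of this file:

* **Solution class (technique class too wide).** The wild solutions of Theorem 1 start from REST
  (zero datum, `v(t) = 0` for `t ≤ 0`) and are non-zero later, so every one of them GAINS kinetic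
  energy: any solution class carrying the energy inequality from the initial time — Leray–Hopf,
  suitable, limits of Galerkin / Leray-regularised / vanishing-(hyper)viscosity approximations —
  contains only the zero solution from this datum, at EVERY exponent `θ`
  (`uniqueness_from_rest_of_energy_le`, `LionsExponentSharpness.exists_energy_gain`: no equation
  is used, only `‖v(t)‖_{L²} ≤ ‖v(0)‖_{L²} = 0`). Hence the entry refutes uniqueness /
  well-posedness / weak–strong uniqueness of DISTRIBUTIONAL solutions in `C⁰_t L²_x` (Luo–Titi
  Def. 1.1; Buckmaster–Colombo–Vicol's `C⁰_t(H^β ∩ W^{1,1+β})` gluing of two strong solutions,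
  their Thm. 1.1 with Thm. 1.5 for `α ∈ [1, 5/4)` [cite: BuckmasterColomboVicol2021, §1 Thm. 1.1,
  §1.2 Thm. 1.5]) and nothing about energy-admissible classes or selection principles: "The
  uniqueness of suitable weak solutions or of Leray-Hopf weak solutions is an outstanding open
  problem" [cite: BuckmasterColomboVicol2021, §1.1 p. 4]; even the energy class WITHOUT the
  inequality, `C⁰_t L^q ∩ L²_t H¹`, `q ∈ [2,3)`, is open [cite: BuckmasterColomboVicol2021, §1.1
  p. 4 (last open problem of the paragraph)]. (From NON-ZERO data the separating property is the dissipation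
  bookkeeping — membership in `L²_t H^θ_x` and the energy inequality WITH its dissipation term —
  not monotonicity of the kinetic energy alone: wild solutions with any prescribed smooth, e.g.
  decreasing, energy profile exist at `θ = 1` [cite: BuckmasterVicol2019AnnMath, Thm. 1.2], even
  in `C([0,∞); L²)` from every `L²` datum [cite: CheskidovZengZhang2024, Thms. 1.1–1.2], and for
  `θ < 5/4` by the same scheme [cite: LuoTiti2020, §1 Remark 1]; from the zero datum of this entry
  the weakest form `‖v(t)‖_{L²} ≤ ‖v(0)‖_{L²}` already decides.) The hyperviscous approximation
  `-αΔ²` (`α → 0`)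
  has a unique global solution for `α > 0` and its limits are suitable Leray solutions
  [cite: LemarieRieusset2016, §18.3 Thm. 18.5 (PDF p. 710)] [cite: BeiraoDaVeiga1985, main theorem]
  — a selection mechanism this entry does not touch. In the Leray–Hopf class the `5/4` threshold
  IS a theorem only WITH A FORCE: two Leray–Hopf solutions from rest of the forced system on `ℝ³`
  for every `α ∈ (1/2, 5/4)` [cite: KhorMiaoSu2023, Thm. 1.2], "sharp in a stronger way than the
  non-uniqueness of distributional solutions in [Luo–Titi], albeit with a non-zero forcing term"
  [cite: KhorMiaoSu2023, §1 p. 2], the method "strongly rel[ies] on the equation having a forcing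
  term" [cite: KhorMiaoSu2023, Rmk. 2]; unforced Leray–Hopf non-uniqueness is known only for
  `θ < 1/3` (entry `HypodissipativeLerayNonuniqueness`).
* **Exponent (the threshold is class-relative).** "`5/4` is sharp" is printed for the class
  `C_t L²_x`: "weak solutions in `C_tL²_x` are unique if `α ≥ 5/4`, while non-unique if `α < 5/4`"
  [cite: LiQuZengZhang2022, §1.3 (i)]; "confirm the well-posedness criticality of the exponent
  `α = 5/4`, within the class of weak solutions defined in Definition [1.1]"
  [cite: BuckmasterColomboVicol2021, §1.2 p. 5]. It is NOT a threshold for very weak solutions as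
  such: for every `α ∈ [5/4, 2)` distributional solutions stay non-unique — in the strong sense,
  from every datum — in the supercritical classes `L^γ_t W^{s,p}_x`, `(s,γ,p) ∈ 𝓐₁ ∪ 𝓐₂`, and in
  `C_t L^p_x`, `p < 3/(2α-1)` [cite: LiQuZengZhang2022, Thm. 1.2, Cor. 1.3, Cor. 1.4], sharp at
  the two endpoints of the generalised Ladyženskaja–Prodi–Serrin line `2α/γ + 3/p = 2α - 1 + s`
  [cite: LiQuZengZhang2022, §1.3 (ii)]. So the evasion "`θ ≥ 5/4`" restores uniqueness exactly in
  classes at or above that line (the energy space `C_t L²_x` becomes critical at `5/4`), and the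
  obstruction below `5/4` is the `L²`-supercriticality of the class, not the weakness of the
  dissipation; the remaining supercritical regimes are open on both sides of `5/4` ("out of the
  reach of present method, due to the `L²_{t,x}`-criticality of space-time convex integration")
  [cite: LiQuZengZhang2022, §1.3 (ii), last paragraph].

## References

* T. Luo, E. S. Titi, Calc. Var. PDE 59 (2020), Paper 92; arXiv:1808.07595, §1. [`LuoTiti2020`]
* T. Buckmaster, V. Vicol, Ann. of Math. 189 (2019), Thms. 1.1–1.3. [`BuckmasterVicol2019AnnMath`]
* T. Tao, Anal. PDE 2 (2009), §1. [`Tao2009`]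
* T. Tao, J. Amer. Math. Soc. 29 (2016), §1.2 footnote p. 8. [`Tao2016AveragedNS`]
* M. Colombo, C. De Lellis, L. De Rosa, Comm. Math. Phys. 362 (2018). [`ColomboDelellisDerosa2018`]
* L. De Rosa, Comm. PDE 44 (2019). [`Derosa2018`]
* T. Buckmaster, M. Colombo, V. Vicol, J. Eur. Math. Soc. 24 (2022), 3333–3378 = arXiv:1809.00600,
  §1 Thm. 1.1, Rmks. 1.2–1.4, §1.2 Thm. 1.5. [`BuckmasterColomboVicol2021`]
* Y. Li, P. Qu, Z. Zeng, D. Zhang, J. Math. Pures Appl. (2024) = arXiv:2205.10260, §1.2 Def. 1.1,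
  Thm. 1.2, Cors. 1.3–1.4, Thm. 1.5, §1.3 (i)–(ii). [`LiQuZengZhang2022`]
* C. Khor, C. Miao, X. Su, Bull. Lond. Math. Soc. 55 (2023), 2705–2717 = arXiv:2306.06358, §1
  Thm. 1.2, Rmks. 1–2. [`KhorMiaoSu2023`]
* P. G. Lemarié-Rieusset, *The Navier–Stokes Problem in the 21st Century*, CRC Press (2016), §18.3
  Thm. 18.5. [`LemarieRieusset2016`]
* H. Beirão da Veiga, J. Math. Pures Appl. 64 (1985), 77–86. [`BeiraoDaVeiga1985`]
* A. Cheskidov, Z. Zeng, D. Zhang, arXiv:2407.17463 (2024), Thms. 1.1–1.2. [`CheskidovZengZhang2024`]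
-/

noncomputable section

open MeasureTheory Set
open scoped ENNReal

namespace Literature.Barriers.NavierStokesRegularity

local notation "𝕋³" => UnitAddTorus (Fin 3)
local notation "ℝ³" => EuclideanSpace ℝ (Fin 3)

/-- **Luo–Titi 2020, Theorem 1, consequence clause** (as printed): for `θ ∈ [1, 5/4)` "there are
infinitely many weak solutions of the FVNSE (1.1) which are compactly supported in time; in
particular, there are infinitely many weak solutions with initial values zero." Weak solutions are
Luo–Titi's Def. 1.1 (`v ∈ C⁰_weak(ℝ; L²(𝕋³))` solving `∂ₜv + ∇·(v⊗v) + ∇p + ν(-Δ)^θ v = 0`,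
`∇·v = 0` in the sense of distributions on `ℝ × 𝕋³`), in-tree `Torus.IsWeakFracNSSolutionLine θ ν`;
"infinitely many … with initial values zero" is a sequence of such solutions, each vanishing for
`t ≤ 0` and for `t ≥ b` (compact support in time inside `[0, b]`), pairwise distinct modulo
space-time null sets (`∫_ℝ ∫‖v_m - v_n‖² ≠ 0`; for the weakly continuous fields of Def. 1.1 this
is the same as differing in `L²` at one time, but it is the formulation that stays meaningful for
a.e.-defined solution classes, cf. `Torus.HasInfinitelyManyLeraySolutions`). `ν > 0` is the
(fixed, arbitrary) viscosity of (1.1). Unit-torus normalisation (equivalent by scaling, see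
`FractionalNSTorus`). [cite: LuoTiti2020, §1 main theorem (Theorem 1 of the arXiv text), consequence clause] -/
def LuoTiti2020_infinitelyMany : Prop :=
  ∀ θ ν : ℝ, 1 ≤ θ → θ < 5 / 4 → 0 < ν →
    ∃ v : ℕ → ℝ → 𝕋³ → ℝ³,
      (∀ n, Literature.Analysis.FluidPDE.Torus.IsWeakFracNSSolutionLine θ ν (v n)) ∧
      (∀ n, (∀ t : ℝ, t ≤ 0 → v n t = 0) ∧ ∃ b : ℝ, ∀ t : ℝ, b ≤ t → v n t = 0) ∧
      ∀ m n, m ≠ n → ∫⁻ t, Literature.Analysis.FluidPDE.Torus.eL2NormSq (v m t - v n t) ≠ 0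

/-- **Barrier (Luo–Titi 2020): J.-L. Lions' exponent `5/4` is sharp for uniqueness of weak
solutions — hyperviscous regularisation `ν(-Δ)^θ`, `1 ≤ θ < 5/4`, does not restore uniqueness of
`C⁰_t L²_x` weak solutions on `𝕋³`.** Definitionally the named fact `LuoTiti2020_infinitelyMany`
(not proved here). [cite: LuoTiti2020, §1 main theorem (Theorem 1 of the arXiv text)]

BARRIER (structured block, D-0021):
- technique_class: hyperviscous-regularisation-below-lions-exponent, supercritical-hyperdissipation, weak-solution-uniqueness-in-energy-space, vanishing-hyperviscosity-selection — arguments expecting uniqueness (well-posedness) of finite-energy weak solutions, or a selection principle among them, from ADDING dissipation `(-Δ)^θ` with `θ < 5/4`, i.e. while the energy stays supercritical (`(d+2)/4 = 5/4` for `d = 3`) [cite: Tao2009, §1] [cite: LuoTiti2020, abstract and §1]; NARROWED (audit 2026-08-16): of this class only the sub-family acting on DISTRIBUTIONAL (very weak) solutions in `C⁰_t L²_x` WITHOUT the energy inequality and without `L²_t H^θ_x` control is covered by the printed theorem — uniqueness, well-posedness or weak–strong uniqueness in that class; uniqueness in energy-admissible classes (Leray–Hopf, suitable, vanishing-(hyper)viscosity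 / Galerkin limits) and every selection principle among them are NOT covered (the wild solutions start from rest and gain energy: `uniqueness_from_rest_of_energy_le`, `LionsExponentSharpness.exists_energy_gain`, `LionsExponentSharpnessNarrow` below) [cite: BuckmasterColomboVicol2021, §1.1 p. 4 and Rmk. 1.3] [cite: KhorMiaoSu2023, §1 p. 2 and Rmk. 2]
- blocks: the strengthening "weak solutions `v ∈ C⁰_t L²_x` of the (hyper)viscous system on `𝕋³` are unique / determined by their initial datum" for every `θ ∈ [1, 5/4)` — at `θ = 1` this is the in-tree Buckmaster–Vicol entry (`BuckmasterVicolNonuniqueness`, `Literature.Analysis.FluidPDE.buckmasterVicol_nonuniqueness`, ns.S18), and the present entry extends the failure to the whole supercritical hyperdissipative range [cite: LuoTiti2020, §1 main theorem and Remark 1] [cite: BuckmasterVicol2019AnnMath, Thms. 1.2–1.3]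
- because: the intermittent convex-integration scheme of Buckmaster–Vicol (intermittent Beltrami flows) absorbs the error created by `ν(-Δ)^θ v` using the concentration of the building blocks; "the error is controllable only for `θ < 5/4`", and the Iteration Lemma (§2.1, Lemma 1 of the arXiv text, stated for `θ ∈ (-∞, 5/4)`) converges in `C⁰_t L²_x`, giving for any smooth zero-mean divergence-free `u` with compact time support a weak solution `v` with `‖v - u‖_{L^∞_t W^{2θ-1,1}_x} < ε₀`, hence infinitely many weak solutions with zero initial values [cite: LuoTiti2020, §1 main theorem, §2.1 Lemma 1 and proof]
- evasions_known: `θ ≥ 5/4`: existence AND uniqueness of weak solutions with the energy equality (J.-L. Lions 1969) [cite: LuoTiti2020, §1]; global regularity of smooth solutions for `α ≥ (d+2)/4` ("folklore") and slightly below (logarithmically supercritical symbols) [cite: Tao2009, §1 and Theorem 1]; restricting to Leray–Hopf solutions (energy inequality): the solutions here and Buckmaster–Vicol's are not shown to be Leray–Hopf, and Leray–Hopf non-uniqueness is only known for weak dissipation `θ < 1/3` [cite: Derosa2018, §1 Thm. 1.2] [cite: ColomboDelellisDerosa2018, §1 Thm. 1.2]; partial regularity improves continuously up to the exponent: singular set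 of dimension `≤ 5 - 4θ` for `θ ∈ (1, 5/4)` (Katz–Pavlović) [cite: LuoTiti2020, §1]; (audit 2026-08-16) ANY energy inequality from the initial time: from the zero datum of the entry it leaves only `v ≡ 0`, at every `θ` (in-file theorem `uniqueness_from_rest_of_energy_le`, [folklore]); in particular the hyperviscous approximation `-αΔ²`, `α → 0`, whose limits are suitable Leray solutions [cite: LemarieRieusset2016, §18.3 Thm. 18.5 (PDF p. 710)]; working in a class at or above the generalised Ladyženskaja–Prodi–Serrin line `2θ/γ + 3/p = 2θ - 1 + s` (e.g. `L^γ_t L^p_x`, `2θ/γ + 3/p ≤ 2θ - 1`), where distributional solutions are unique for every `θ` [cite: LiQuZengZhang2022, §1.1 p. 4 (uniqueness results under the generalised condition, [Z07], [W06]) and §1.3 (ii)]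
- scope_caveats: (i) a statement about `C⁰_t L²_x` (very) weak solutions on the periodic box, not about Leray–Hopf or smooth solutions; it does not bear on uniqueness of smooth solutions, which holds for every `θ ≥ 0` locally in time, nor directly on NavierStokesRegularity (Clay (A)/(B) concern smooth solutions) [cite: LuoTiti2020, §1 Def. 1.1]; (ii) only `θ ∈ [1, 5/4)` is covered by Theorem 1 as stated (`θ < 1` by Remark 2 with a different regularity class; `θ = 5/4` and beyond excluded) [cite: LuoTiti2020, §1 Theorem 1 and Remark 2]; (iii) the vendored Lean statement is the "As a consequence" clause only (infinitely many compactly supported weak solutions with zero initial values); the quantitative approximation `‖v - u‖_{L^∞_t W^{2θ-1,1}_x} < ε₀` and Remark 1 (`C⁰_t W^{β,2}_x` solutions) are not transcribed; unit-torus normalisation `(ℝ/ℤ)³` with symbol `(2π|k|)^{2θ}` instead of the printed `|ξ|^{2θ}` (equivalent by scaling, `FractionalNSTorus` design notes); (iv) Tao's averaged blow-up likewise persists for hyperdissipation `α < 5/4`, a different (smooth-solution) manifestation of the same threshold [cite: Tao2016AveragedNS, §1.2 footnote p. 8]; (v) named fact, not proved in this file (reduced in the tree to the named fact `Torus.LuoTiti2020_iterationLemma`,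 see `LionsExponentSharpnessIteration`); (vi) (audit 2026-08-16) COVERAGE: the refuted principle is exactly `LionsExponentSharpnessNarrow` — uniqueness of the zero-datum Cauchy problem among distributional `C⁰_w L²` solutions with no energy inequality; its energy-admissible restriction HOLDS trivially for all `θ` (`uniqueness_from_rest_of_energy_le`), so the tags `weak-solution-uniqueness-in-energy-space` (read as Leray–Hopf) and `vanishing-hyperviscosity-selection` are not backed by the printed theorem (from non-zero data kinetic-energy monotonicity alone does not separate the classes — prescribed decreasing energy profiles are realised by wild solutions [cite: BuckmasterVicol2019AnnMath, Thm. 1.2] [cite: CheskidovZengZhang2024, Thm. 1.2] [cite: LuoTiti2020, §1 Remark 1] — the separating property is `L²_t H^θ_x` plus the energy inequality with dissipation); Leray–Hopf / suitable uniqueness for `θ ∈ [1/3, 5/4)` is open without force [cite: BuckmasterColomboVicol2021, §1.1 p. 4], refuted WITH a force on `ℝ³` for `α ∈ (1/2, 5/4)` from rest [cite: KhorMiaoSu2023, Thm. 1.2 and Rmks. 1–2]; the strongest printed very-weak statement below `5/4` glues two STRONG solutions (failure of weak–strong uniqueness in `C⁰_t(H^β ∩ W^{1,1+β})`, singular times of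 dimension `< 1`) [cite: BuckmasterColomboVicol2021, §1 Thm. 1.1 and §1.2 Thm. 1.5]; (vii) (audit 2026-08-16) THRESHOLD IS CLASS-RELATIVE: `5/4` is where `C_t L²_x` becomes critical ("weak solutions in `C_tL²_x` are unique if `α ≥ 5/4`, while non-unique if `α < 5/4`" [cite: LiQuZengZhang2022, §1.3 (i)]; "within the class of weak solutions defined in Definition [1.1]" [cite: BuckmasterColomboVicol2021, §1.2 p. 5]); for `α ∈ [5/4, 2)` distributional solutions remain non-unique from every datum in the supercritical classes `L^γ_t W^{s,p}_x`, `(s,γ,p) ∈ 𝓐₁ ∪ 𝓐₂`, and `C_t L^p_x`, `p < 3/(2α-1)` [cite: LiQuZengZhang2022, Thm. 1.2, Cor. 1.3, Cor. 1.4] — adding dissipation above Lions' exponent does not restore uniqueness of very weak solutions, only of `L²`-(sub)critical classes; the other supercritical regimes are open on both sides of `5/4` [cite: LiQuZengZhang2022, §1.3 (ii)]; (viii) uniqueness AT `θ = 5/4` in Luo–Titi's own class `C⁰_w L²` (weak, not norm, continuity; no `L²_t H^{5/4}_x` assumed) is asserted in the secondary sources by reference to Lions 1969, whose theorem is stated for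 the energy class [cite: BuckmasterColomboVicol2021, §1.2 p. 5 ("existence and uniqueness of Leray-weak solutions")] [cite: LuoTiti2020, §1 ("which also satisfied the energy equality")] — the audit did not find a printed proof for the weakly continuous distributional class at the endpoint and records it as unverified fine print, not as a gap of the entry
- status: established (content); coverage narrowed 2026-08-16 -/
def LionsExponentSharpness : Prop :=
  LuoTiti2020_infinitelyMany

/-- The catalogue entry is the Luo–Titi fact, by definition.
[cite: LuoTiti2020, §1 main theorem (Theorem 1 of the arXiv text)] -/
theorem lionsExponentSharpness_iff : LionsExponentSharpness ↔ LuoTiti2020_infinitelyMany :=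
  Iff.rfl

/-- Consequence: for every `θ ∈ [1, 5/4)` and `ν > 0` there are two weak solutions on the time line,
both vanishing for `t ≤ 0` (zero initial values), that are not a.e. equal on `(0,∞) × 𝕋³` —
non-uniqueness of the Cauchy problem from zero in Luo–Titi's class (the difference vanishes for
`t ≤ 0`, so all of `∫_ℝ∫‖v - w‖² ≠ 0` comes from positive times).
[cite: LuoTiti2020, §1 main theorem (Theorem 1 of the arXiv text), consequence clause] -/
theorem LionsExponentSharpness.exists_two (h : LionsExponentSharpness) {θ ν : ℝ} (h1 : 1 ≤ θ)
    (h2 : θ < 5 / 4) (hν : 0 < ν) :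
    ∃ v w : ℝ → 𝕋³ → ℝ³, Literature.Analysis.FluidPDE.Torus.IsWeakFracNSSolutionLine θ ν v ∧
      Literature.Analysis.FluidPDE.Torus.IsWeakFracNSSolutionLine θ ν w ∧ (∀ t : ℝ, t ≤ 0 → v t = 0) ∧
      (∀ t : ℝ, t ≤ 0 → w t = 0) ∧ ∫⁻ t in Ioi 0, Literature.Analysis.FluidPDE.Torus.eL2NormSq (v t - w t) ≠ 0 := by
  obtain ⟨v, hsol, hsupp, hdist⟩ := h θ ν h1 h2 hν
  refine ⟨v 0, v 1, hsol 0, hsol 1, (hsupp 0).1, (hsupp 1).1, ?_⟩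
  have hne := hdist 0 1 (by norm_num)
  have hzero : ∫⁻ t in (Ioi (0 : ℝ))ᶜ, Literature.Analysis.FluidPDE.Torus.eL2NormSq (v 0 t - v 1 t) = 0 := by
    refine le_antisymm ?_ bot_le
    calc ∫⁻ t in (Ioi (0 : ℝ))ᶜ, Literature.Analysis.FluidPDE.Torus.eL2NormSq (v 0 t - v 1 t)
        ≤ ∫⁻ _t in (Ioi (0 : ℝ))ᶜ, (0 : ℝ≥0∞) := by
          refine setLIntegral_mono' measurableSet_Ioi.compl fun t ht => ?_
          have ht' : t ≤ 0 := not_lt.mp ht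
          rw [(hsupp 0).1 t ht', (hsupp 1).1 t ht', sub_zero, Literature.Analysis.FluidPDE.Torus.eL2NormSq_zero_fun]
      _ = 0 := by simp
  intro h0
  apply hne
  rw [← lintegral_add_compl _ (measurableSet_Ioi (a := (0 : ℝ))), h0, hzero, zero_add]


/-! ## Audit (D-0021, 2026-08-16): the exact principle refuted, and its energy-admissible
complement, which holds at every exponent -/

section Audit

open Literature.Analysis.FluidPDE

/-- **The uniqueness principle refuted by the entry — normal form of what it blocks (audit
2026-08-16).** Under the catalogue fact, for every `θ ∈ [1, 5/4)` and `ν > 0` it is FALSE that two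
weak solutions on the time line in Luo–Titi's class (`Torus.IsWeakFracNSSolutionLine θ ν`:
jointly measurable, slices in `L²`, weakly continuous, weakly divergence free, distributional
momentum identity — and NOTHING else: no energy inequality, no `L²_t H^θ_x` bound) which both
vanish for `t ≤ 0` (zero initial datum) agree modulo null sets on `(0, ∞) × 𝕋³`. This implication
uses nothing but `LionsExponentSharpness.exists_two`; a uniqueness statement the entry is invoked
against must therefore quantify over this very weak class (or a class shown to contain the wild
solutions, e.g. `C⁰_t(H^β ∩ W^{1,1+β})` [cite: BuckmasterColomboVicol2021, §1 Thm. 1.1 and §1.2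
Thm. 1.5]) — see `uniqueness_from_rest_of_energy_le` for the complementary principle that survives.
[cite: LuoTiti2020, §1 main theorem (Theorem 1 of the arXiv text), consequence clause] -/
theorem LionsExponentSharpnessNarrow (h : LionsExponentSharpness) {θ ν : ℝ} (h1 : 1 ≤ θ)
    (h2 : θ < 5 / 4) (hν : 0 < ν) :
    ¬ (∀ v w : ℝ → 𝕋³ → ℝ³, Torus.IsWeakFracNSSolutionLine θ ν v →
        Torus.IsWeakFracNSSolutionLine θ ν w → (∀ t : ℝ, t ≤ 0 → v t = 0) →
        (∀ t : ℝ, t ≤ 0 → w t = 0) → ∫⁻ t in Ioi 0, Torus.eL2NormSq (v t - w t) = 0) := by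
  intro huniq
  obtain ⟨v, w, hv, hw, hv0, hw0, hne⟩ := h.exists_two h1 h2 hν
  exact hne (huniq v w hv hw hv0 hw0)

/-- **Energy-admissible fields from rest have zero energy forever, at every exponent.** If
`v t = 0` for `t ≤ 0` and the kinetic energy never exceeds its initial value,
`∫‖v(t)‖² ≤ ∫‖v(0)‖²` for `t ≥ 0` — the weakest consequence of ANY energy inequality from the
initial time (Leray–Hopf, suitable, Galerkin / Leray-regularised / vanishing-(hyper)viscosity
limits all satisfy it) — then every slice has zero `L²` norm. No equation and no exponent enter.
[folklore] -/
theorem eL2NormSq_eq_zero_of_energy_le_from_rest {v : ℝ → 𝕋³ → ℝ³}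
    (h0 : ∀ t : ℝ, t ≤ 0 → v t = 0)
    (hE : ∀ t : ℝ, 0 ≤ t → Torus.eL2NormSq (v t) ≤ Torus.eL2NormSq (v 0)) (t : ℝ) :
    Torus.eL2NormSq (v t) = 0 := by
  have hz : Torus.eL2NormSq (v 0) = 0 := by rw [h0 0 le_rfl, Torus.eL2NormSq_zero_fun]
  rcases le_or_gt t 0 with ht | ht
  · rw [h0 t ht, Torus.eL2NormSq_zero_fun]
  · exact le_antisymm ((hE t ht.le).trans hz.le) bot_le

/-- For a weak solution on the line (slices in `L²`, hence a.e. strongly measurable) from rest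
obeying `∫‖v(t)‖² ≤ ∫‖v(0)‖²` for `t ≥ 0`, every time slice vanishes almost everywhere.
[folklore] -/
theorem ae_eq_zero_of_energy_le_from_rest {θ ν : ℝ} {v : ℝ → 𝕋³ → ℝ³}
    (hv : Torus.IsWeakFracNSSolutionLine θ ν v) (h0 : ∀ t : ℝ, t ≤ 0 → v t = 0)
    (hE : ∀ t : ℝ, 0 ≤ t → Torus.eL2NormSq (v t) ≤ Torus.eL2NormSq (v 0)) (t : ℝ) :
    v t =ᵐ[volume] 0 := by
  have hint : ∫⁻ x, ‖v t x‖ₑ ^ 2 = 0 := eL2NormSq_eq_zero_of_energy_le_from_rest h0 hE t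
  have hmeas : AEMeasurable (fun x => ‖v t x‖ₑ ^ 2) volume :=
    ((hv.2.1 t).aestronglyMeasurable.enorm.pow_const 2)
  filter_upwards [(lintegral_eq_zero_iff' hmeas).mp hint] with x hx
  have hx' : ‖v t x‖ₑ ^ 2 = 0 := hx
  simpa using hx'

/-- **The energy-admissible restriction of the refuted principle HOLDS, for every `θ` and `ν`
(audit 2026-08-16).** Two weak solutions on the line in Luo–Titi's class, both vanishing for
`t ≤ 0` and both obeying the energy inequality from the initial time in its weakest form
`∫‖v(t)‖² ≤ ∫‖v(0)‖²` (`t ≥ 0`), agree modulo null sets on `(0,∞) × 𝕋³` — indeed both vanish.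
Compare `LionsExponentSharpnessNarrow`: the same principle without the energy hypothesis fails
for `θ ∈ [1, 5/4)`. So the entry cannot be invoked against uniqueness or selection arguments in
Leray–Hopf / suitable / vanishing-(hyper)viscosity-limit classes, whose members satisfy this
inequality (e.g. the hyperviscous approximation, [cite: LemarieRieusset2016, §18.3 Thm. 18.5
(PDF p. 710)]); for those the obstruction below `5/4` is the OPEN Leray–Hopf uniqueness problem
[cite: BuckmasterColomboVicol2021, §1.1 p. 4], a theorem only with forcing
[cite: KhorMiaoSu2023, Thm. 1.2]. [folklore] -/
theorem uniqueness_from_rest_of_energy_le (θ ν : ℝ) (v w : ℝ → 𝕋³ → ℝ³)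
    (hv : Torus.IsWeakFracNSSolutionLine θ ν v) (hw : Torus.IsWeakFracNSSolutionLine θ ν w)
    (hv0 : ∀ t : ℝ, t ≤ 0 → v t = 0) (hw0 : ∀ t : ℝ, t ≤ 0 → w t = 0)
    (hvE : ∀ t : ℝ, 0 ≤ t → Torus.eL2NormSq (v t) ≤ Torus.eL2NormSq (v 0))
    (hwE : ∀ t : ℝ, 0 ≤ t → Torus.eL2NormSq (w t) ≤ Torus.eL2NormSq (w 0)) :
    ∫⁻ t in Ioi 0, Torus.eL2NormSq (v t - w t) = 0 := by
  have hslice : ∀ t, Torus.eL2NormSq (v t - w t) = 0 := fun t => by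
    have h1 := ae_eq_zero_of_energy_le_from_rest hv hv0 hvE t
    have h2 := ae_eq_zero_of_energy_le_from_rest hw hw0 hwE t
    unfold Torus.eL2NormSq
    rw [lintegral_congr_ae (g := fun _ => (0 : ℝ≥0∞)) ?_]
    · exact lintegral_zero
    filter_upwards [h1, h2] with x hx1 hx2
    have hx1' : v t x = 0 := by simpa using hx1
    have hx2' : w t x = 0 := by simpa using hx2
    simp [hx1', hx2']
  simp [hslice]

/-- **The wild solutions gain energy from rest (so none of them is energy-admissible), a
consequence of the entry (audit 2026-08-16).** Under the catalogue fact, for every `θ ∈ [1, 5/4)`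
and `ν > 0` there is a weak solution on the line in Luo–Titi's class with zero initial datum
(`v t = 0` for `t ≤ 0`) whose kinetic energy at some time `t ≥ 0` strictly exceeds its (zero)
initial energy — it violates every energy inequality from the initial time; in print "the weak
solutions constructed … are not Leray-Hopf" [cite: BuckmasterColomboVicol2021, Rmk. 1.3]. Proof:
otherwise `uniqueness_from_rest_of_energy_le` would identify the two solutions of
`LionsExponentSharpness.exists_two`. [cite: LuoTiti2020, §1 main theorem (Theorem 1 of the arXiv
text), consequence clause] -/
theorem LionsExponentSharpness.exists_energy_gain (h : LionsExponentSharpness) {θ ν : ℝ}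
    (h1 : 1 ≤ θ) (h2 : θ < 5 / 4) (hν : 0 < ν) :
    ∃ v : ℝ → 𝕋³ → ℝ³, Torus.IsWeakFracNSSolutionLine θ ν v ∧ (∀ t : ℝ, t ≤ 0 → v t = 0) ∧
      ∃ t : ℝ, 0 ≤ t ∧ Torus.eL2NormSq (v 0) < Torus.eL2NormSq (v t) := by
  obtain ⟨v, w, hv, hw, hv0, hw0, hne⟩ := h.exists_two h1 h2 hν
  by_contra hcon
  push Not at hcon
  exact hne (uniqueness_from_rest_of_energy_le θ ν v w hv hw hv0 hw0 (hcon v hv hv0) (hcon w hw hw0))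

end Audit

end Literature.Barriers.NavierStokesRegularity
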